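import Summits.Ventures.LatticeQCDFlow.Scoring.NonabelianAreaLaw2DWilsonLoop
import HarnessLib

/-!
# The exact non-abelian area law in two dimensions, V-a: peeling one plaquette off a weighted set; coordinates on `(ℤ/L)²`

HONEST FRAMING: exact (Metropolis-corrected) sampling algorithms for lattice gauge theory;
figures of merit are autocorrelation/cost numbers at stated couplings and volumes; no
continuum-physics claim.

Venture `LatticeQCDFlow` (cell pub-lqcd), sub-topic `Scoring`; FANOUT row 5 (`s0-sun-a`), GEN-18.
NEW WORK of the cell (placement rule); the two small tools of the punctured-torus peeling
(`NonabelianAreaLaw2DTorusPeel`), for every compact second-countable gauge group: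

* §1 **`integral_mul_prod_insert_peel`** (and `…_inv`) — peel the plaquette `q ∉ s` off the weight
  `∏_{x ∈ insert q s} v(U_x)` through a link `e` entering `U_q` as `A·U_e·B` (resp. `A·U_e⁻¹·B`), when the
  observable `Φ`, the coefficients and the plaquettes of `s` ignore `e`:
  `∫ Φ ∏_{insert q s} v(U_x) = (∫ v) ∫ Φ ∏_{s} v(U_x)` (part I, one-link peeling);
* §2 coordinates: `site_eq_iff`, `shift_zero_apply`, `shift_one_apply`, `val_sub_one_eq`, `val_add_one_eq`,
  `mem_rect_iff` (membership in `{(i'+a, j'+b) : a < R, b < T}` through `ZMod.val`).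

No `def`, nothing cited as a fact, 0 sorry.
-/

noncomputable section

open MeasureTheory Function Finset
open Literature.MathematicalPhysics.QuantumFieldTheory
open Literature.MathematicalPhysics.QuantumLattice
open Summit.Ventures.LatticeQCDFlow.Theory2.Lattice
open Summit.Ventures.LatticeQCDFlow.Theory2.Lattice.TwoDim

namespace Summit.Ventures.LatticeQCDFlow.Scoring

variable {L : ℕ} [NeZero L] {G : Type*} [Group G] [TopologicalSpace G] [IsTopologicalGroup G]
  [CompactSpace G] [SecondCountableTopology G] [MeasurableSpace G] [BorelSpace G]

/-! ## §1. Peeling one plaquette off a weighted set -/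

section OnePlaquette

variable {v : G → ℝ} (hv : Continuous v) {Φ : GaugeConfig 2 L G → ℂ} (hΦ : Continuous Φ)
include hv hΦ

/-- Peel the plaquette `q ∉ s` through a link `e` entering its holonomy directly
(`U_q = A · U_e · B`), when `Φ` and the plaquettes of `s` ignore `e`. -/
theorem integral_mul_prod_insert_peel {q : Site 2 L} {s : Finset (Site 2 L)} (hq : q ∉ s) (e : Edge 2 L)
    {A B : GaugeConfig 2 L G → G} (hA : Continuous A) (hB : Continuous B)
    (hAe : ∀ (U : GaugeConfig 2 L G) (g : G), A (update U e g) = A U)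
    (hBe : ∀ (U : GaugeConfig 2 L G) (g : G), B (update U e g) = B U)
    (hword : ∀ U : GaugeConfig 2 L G, plaquetteHolonomy U q 0 1 = A U * U e * B U)
    (hΦe : ∀ (U : GaugeConfig 2 L G) (g : G), Φ (update U e g) = Φ U)
    (hs : ∀ x ∈ s, ∀ (U : GaugeConfig 2 L G) (g : G),
      plaquetteHolonomy (update U e g) x 0 1 = plaquetteHolonomy U x 0 1) :
    ∫ U, Φ U * ∏ x ∈ insert q s, (v (plaquetteHolonomy U x 0 1) : ℂ)
        ∂(Measure.pi fun _ : Edge 2 L => haarProbability G) =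
      (∫ g, (v g : ℂ) ∂(haarProbability G)) *
        ∫ U, Φ U * ∏ x ∈ s, (v (plaquetteHolonomy U x 0 1) : ℂ)
          ∂(Measure.pi fun _ : Edge 2 L => haarProbability G) := by
  have hpt : ∀ U : GaugeConfig 2 L G, Φ U * ∏ x ∈ insert q s, (v (plaquetteHolonomy U x 0 1) : ℂ) =
      (v (A U * U e * B U) : ℂ) * (Φ U * ∏ x ∈ s, (v (plaquetteHolonomy U x 0 1) : ℂ)) := by
    intro U
    rw [Finset.prod_insert hq, hword]
    ring
  simp_rw [hpt]
  have hΨ : Continuous fun U : GaugeConfig 2 L G => Φ U * ∏ x ∈ s, (v (plaquetteHolonomy U x 0 1) : ℂ) :=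
    hΦ.mul (continuous_finsetProd _ fun x _ =>
      Complex.continuous_ofReal.comp (hv.comp (continuous_config_plaquetteHolonomy x 0 1)))
  have hΨe : ∀ U g, Φ (update U e g) * ∏ x ∈ s, (v (plaquetteHolonomy (update U e g) x 0 1) : ℂ) =
      Φ U * ∏ x ∈ s, (v (plaquetteHolonomy U x 0 1) : ℂ) := by
    intro U g
    rw [hΦe]
    congr 1
    exact Finset.prod_congr rfl fun x hx => by rw [hs x hx]
  have h := integral_comp_link_mul_eq e hΨ hΨe hA hB hAe hBe (f := fun g => (v g : ℂ))
    (Complex.continuous_ofReal.comp hv)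
  simp only at h
  exact h

/-- The same with the link entering inverted (`U_q = A · U_e⁻¹ · B`). -/
theorem integral_mul_prod_insert_peel_inv {q : Site 2 L} {s : Finset (Site 2 L)} (hq : q ∉ s) (e : Edge 2 L)
    {A B : GaugeConfig 2 L G → G} (hA : Continuous A) (hB : Continuous B)
    (hAe : ∀ (U : GaugeConfig 2 L G) (g : G), A (update U e g) = A U)
    (hBe : ∀ (U : GaugeConfig 2 L G) (g : G), B (update U e g) = B U)
    (hword : ∀ U : GaugeConfig 2 L G, plaquetteHolonomy U q 0 1 = A U * (U e)⁻¹ * B U)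
    (hΦe : ∀ (U : GaugeConfig 2 L G) (g : G), Φ (update U e g) = Φ U)
    (hs : ∀ x ∈ s, ∀ (U : GaugeConfig 2 L G) (g : G),
      plaquetteHolonomy (update U e g) x 0 1 = plaquetteHolonomy U x 0 1) :
    ∫ U, Φ U * ∏ x ∈ insert q s, (v (plaquetteHolonomy U x 0 1) : ℂ)
        ∂(Measure.pi fun _ : Edge 2 L => haarProbability G) =
      (∫ g, (v g : ℂ) ∂(haarProbability G)) *
        ∫ U, Φ U * ∏ x ∈ s, (v (plaquetteHolonomy U x 0 1) : ℂ)
          ∂(Measure.pi fun _ : Edge 2 L => haarProbability G) := by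
  have hpt : ∀ U : GaugeConfig 2 L G, Φ U * ∏ x ∈ insert q s, (v (plaquetteHolonomy U x 0 1) : ℂ) =
      (v (A U * (U e)⁻¹ * B U) : ℂ) * (Φ U * ∏ x ∈ s, (v (plaquetteHolonomy U x 0 1) : ℂ)) := by
    intro U
    rw [Finset.prod_insert hq, hword]
    ring
  simp_rw [hpt]
  have hΨ : Continuous fun U : GaugeConfig 2 L G => Φ U * ∏ x ∈ s, (v (plaquetteHolonomy U x 0 1) : ℂ) :=
    hΦ.mul (continuous_finsetProd _ fun x _ =>
      Complex.continuous_ofReal.comp (hv.comp (continuous_config_plaquetteHolonomy x 0 1)))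
  have hΨe : ∀ U g, Φ (update U e g) * ∏ x ∈ s, (v (plaquetteHolonomy (update U e g) x 0 1) : ℂ) =
      Φ U * ∏ x ∈ s, (v (plaquetteHolonomy U x 0 1) : ℂ) := by
    intro U g
    rw [hΦe]
    congr 1
    exact Finset.prod_congr rfl fun x hx => by rw [hs x hx]
  have h := integral_comp_link_inv_mul_eq e hΨ hΨe hA hB hAe hBe (f := fun g => (v g : ℂ))
    (Complex.continuous_ofReal.comp hv)
  simp only at h
  exact h

end OnePlaquette

/-! ## §2. Coordinates on `(ℤ/L)²` -/

section Coord

omit [Group G] [TopologicalSpace G] [IsTopologicalGroup G] [CompactSpace G] [SecondCountableTopology G]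
  [MeasurableSpace G] [BorelSpace G]

omit [NeZero L] in
/-- Two sites agree iff both coordinates agree. -/
theorem site_eq_iff (x y : Site 2 L) : x = y ↔ x 0 = y 0 ∧ x 1 = y 1 := by
  constructor
  · rintro rfl; exact ⟨rfl, rfl⟩
  · rintro ⟨h0, h1⟩
    funext k
    fin_cases k
    exacts [h0, h1]

omit [NeZero L] in
/-- Coordinates of `x + e₀`. -/
theorem shift_zero_apply (x : Site 2 L) : (x.shift 0) 0 = x 0 + 1 ∧ (x.shift 0) 1 = x 1 := by
  simp [Site.shift]

omit [NeZero L] in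
/-- Coordinates of `x + e₁`. -/
theorem shift_one_apply (x : Site 2 L) : (x.shift 1) 0 = x 0 ∧ (x.shift 1) 1 = x 1 + 1 := by
  simp [Site.shift]

/-- In `ZMod L`, `L ≥ 2`: `(z − 1).val = z.val − 1` for `z ≠ 0`. -/
theorem val_sub_one_eq (hL : 2 ≤ L) {z : ZMod L} (hz : z ≠ 0) : (z - 1).val = z.val - 1 := by
  haveI : Fact (1 < L) := ⟨hL⟩
  have h1 : (1 : ZMod L).val ≤ z.val := by
    rw [ZMod.val_one]
    exact Nat.one_le_iff_ne_zero.mpr fun h => hz ((ZMod.val_eq_zero z).mp h)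
  rw [ZMod.val_sub h1, ZMod.val_one]

/-- In `ZMod L`, `L ≥ 2`: `(z + 1).val = z.val + 1` unless `z.val = L − 1`. -/
theorem val_add_one_eq (hL : 2 ≤ L) {z : ZMod L} (hz : z.val ≠ L - 1) : (z + 1).val = z.val + 1 := by
  haveI : Fact (1 < L) := ⟨hL⟩
  have hlt : z.val + (1 : ZMod L).val < L := by
    rw [ZMod.val_one]
    have := ZMod.val_lt z
    omega
  rw [ZMod.val_add_of_lt hlt, ZMod.val_one]

/-- Membership in the rectangle `{(i'+a, j'+b) : a < R, b < T}` (`R, T ≤ L`) in coordinates. -/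
theorem mem_rect_iff (i' j' : ZMod L) {R T : ℕ} (hR : R ≤ L) (hT : T ≤ L) (x : Site 2 L) :
    x ∈ (range R ×ˢ range T).image (fun q : ℕ × ℕ => (![i' + q.1, j' + q.2] : Site 2 L)) ↔
      (x 0 - i').val < R ∧ (x 1 - j').val < T := by
  constructor
  · intro hx
    obtain ⟨⟨a, b⟩, hab, rfl⟩ := Finset.mem_image.mp hx
    rw [Finset.mem_product, Finset.mem_range, Finset.mem_range] at hab
    simp only [Matrix.cons_val_zero, Matrix.cons_val_one, add_sub_cancel_left,
      ZMod.val_natCast, Nat.mod_eq_of_lt (show a < L by omega), Nat.mod_eq_of_lt (show b < L by omega)]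
    exact hab
  · rintro ⟨ha, hb⟩
    refine Finset.mem_image.mpr ⟨((x 0 - i').val, (x 1 - j').val), Finset.mem_product.mpr
      ⟨Finset.mem_range.mpr ha, Finset.mem_range.mpr hb⟩, ?_⟩
    rw [site_eq_iff]
    simp only [Matrix.cons_val_zero, Matrix.cons_val_one, ZMod.natCast_zmod_val]
    constructor <;> ring

end Coord

end Summit.Ventures.LatticeQCDFlow.Scoring
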